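import Summits.QuantumFields.YangMills.Theses.LuscherReduction
import Summits.QuantumFields.YangMills.Theorems.LuscherReductionTwistedTraceScalingOfFemtoTraceLaw
import HarnessLib

/-!
# Crux-idea sketch «time-exact-compression» (ideator #1, gen 1) — stmt-QuantumFields-20203 `LuscherReduction.TwistedTraceScaling`

Typed face of the idea card `Ideas/time-exact-compression.md`.  HONEST FRAMING: sketch of a line on a child of a CONDITIONAL
reduction route (femto rung R2b1 of `LuscherReduction`); nothing here is a mass gap, infinite volume or Clay; no skeleton, no stubs.

Objects (all over tree declarations):
* `transferKernelA ρ βt βs` — the ANISOTROPIC Wilson transfer kernel (temporal coupling `βt`, spatial `βs`); `βt = βs = β` is the tree's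
  `transferKernel ρ β` definitionally (`transferKernelA_diag`).
* `physTraceSuccA / physTraceA / traceRatioA b βt βs T` — VERBATIM copies of `TT.physTraceSucc / TT.physTrace / TraceDoor.traceRatio` with the
  anisotropic kernel (same zero-flux seam `physAvg`), so `traceRatioA b β β = traceRatio b β` (`traceRatioA_diag`).
* `femtoStepsA s ξ β' b = ⌈s ξ b / λ(β', b)⌉` — femto time `s` on the anisotropic base of bare anisotropy `ξ = a_s/a_t`: one coarse time step is
  `1/ξ` of the isotropic one, so `T` scales with `ξ`; at `ξ = L/b` and matched two-loop label this is EXACTLY the fine `femtoSteps s β L`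
  (`femtoStepsA_matched`) — the time direction is never blocked or rounded.
* `AnisoBase` — the ξ-UNIFORM fixed-lattice femto trace law of the anisotropic Wilson base (ξ = 1 is S-BASE of line «twolattice»;
  ξ → ∞ is the Kogut–Susskind/Hamiltonian limit); threshold `∃ β0` kept (honours `Disproof.base_false_without_threshold`).
* `SliceMatch` — fine Wilson at `(L, β)` in the femto window vs the anisotropic base on `b³` at `ξ = L/b`, matched label, `β' ≥ 1`
  (honours `Disproof.tower_false_without_beta1GeOne_of_base`), at the SAME number of time steps.
* `Composition` — PROVED: `AnisoBase → SliceMatch → TwistedTraceScaling` (by name, through the tree's `Tower.twistedTraceScaling_of_femtoTraceLaw`).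
* `FreeJaw` — the first lemma of the last-scale engine: min–max levels of the transfer form COMPRESSED to states factoring through a
  physicality-preserving block map `B` lie below the tree's `levelValue`s (Cauchy interlacing; typed, not proved here).
-/

set_option autoImplicit false

noncomputable section

open MeasureTheory Filter Topology Real
open Literature.MathematicalPhysics.QuantumFieldTheory (GaugeConfig wilsonAction)
open scoped BigOperators

namespace Summit.QuantumFields.YangMills.Cruxes.TwistedTraceScaling.Ideas.TimeExactCompression

open Summit.QuantumFields.YangMills.Theorems.FemtoTransferGap
open Summit.QuantumFields.YangMills.Theorems.FemtoTransferGap.TT (physTrace physTraceSucc physAvg)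
open Summit.QuantumFields.YangMills.Theorems.FemtoTransferGap.TraceDoor
open Summit.QuantumFields.YangMills.Theorems.FemtoTransferGap.TwoLattice.Tower
open Summit.QuantumFields.YangMills.Theses.LuscherReduction (TwistedTraceScaling)

/-! ## §1 The anisotropic Wilson base -/

section Kernel

variable {N : ℕ} {G : Type*} [Group G] (ρ : G →* Matrix (Fin N) (Fin N) ℂ)

/-- **Anisotropic Wilson transfer kernel** `K_{βt,βs}(U,V) = exp(βt ∑ₑ Re tr ρ(UₑVₑ⁻¹) − (βs/2)(S(U)+S(V)))` (temporal-gauge transfer density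
of the anisotropic Wilson action with time-like coupling `βt` and space-like coupling `βs`; bare anisotropy `ξ = (βt/βs)^{1/2}`).
[cite: MontvayMunster1994, (3.145)] -/
def transferKernelA {L : ℕ} [NeZero L] (βt βs : ℝ) (U V : GaugeConfig 3 L G) : ℝ :=
  Real.exp (βt * timeCoupling ρ U V - (βs / 2) * (wilsonAction ρ U + wilsonAction ρ V))

/-- On the diagonal `βt = βs = β` the anisotropic kernel IS the tree's `transferKernel` (definitionally). -/
theorem transferKernelA_diag {L : ℕ} [NeZero L] (β : ℝ) :
    transferKernelA ρ (L := L) β β = transferKernel ρ β := rfl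

end Kernel

/-- Zero-flux trace of `n+1` anisotropic transfer steps (VERBATIM `TT.physTraceSucc` with `transferKernelA`). -/
def physTraceSuccA (L : ℕ) [NeZero L] (βt βs : ℝ) (n : ℕ) : ℝ :=
  ∫ Us : Fin (n + 1) → GaugeConfig 3 L SU2,
    (∏ i : Fin n, transferKernelA su2Rep βt βs (Us i.castSucc) (Us i.succ)) *
      physAvg (transferKernelA su2Rep βt βs (Us (Fin.last n))) (Us 0)
    ∂(Measure.pi fun _ : Fin (n + 1) => configMeasure SU2 L)

/-- `Z^A_phys(L; βt, βs; T)` for `T ≥ 1` steps (VERBATIM `TT.physTrace`). -/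
def physTraceA (L : ℕ) [NeZero L] (βt βs : ℝ) (T : ℕ) : ℝ := physTraceSuccA L βt βs (T - 1)

/-- Anisotropic dyadic trace ratio `r^A = Z^A(2T)/Z^A(T)²` (VERBATIM `TraceDoor.traceRatio`). -/
def traceRatioA (L : ℕ) [NeZero L] (βt βs : ℝ) (T : ℕ) : ℝ :=
  physTraceA L βt βs (2 * T) / physTraceA L βt βs T ^ 2

theorem physTraceSuccA_diag (L : ℕ) [NeZero L] (β : ℝ) (n : ℕ) : physTraceSuccA L β β n = physTraceSucc L β n := rfl

theorem traceRatioA_diag (L : ℕ) [NeZero L] (β : ℝ) (T : ℕ) : traceRatioA L β β T = traceRatio L β T := rfl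

/-- Femto time `s` on the anisotropic base: `T = ⌈s ξ b/λ(β', b)⌉` coarse time steps (`a_t = a_s/ξ`). -/
def femtoStepsA (s ξ β' : ℝ) (b : ℕ) : ℕ := ⌈s * ξ * b / luscherLambda β' b⌉₊

/-- **Same clock, no rounding.**  At bare anisotropy `ξ = L/b` and matched two-loop label the anisotropic femto step count is the fine one. -/
theorem femtoStepsA_matched (s β β' : ℝ) (L b : ℕ) [NeZero b]
    (h : invRunningCoupling β' b = invRunningCoupling β L) :
    femtoStepsA s ((L : ℝ) / b) β' b = femtoSteps s β L := by
  unfold femtoStepsA femtoSteps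
  have hb : (b : ℝ) ≠ 0 := Nat.cast_ne_zero.mpr (NeZero.ne b)
  have hmul : s * ((L : ℝ) / b) * b = s * L := by field_simp
  rw [luscherLambda_eq_of_matched h, hmul]

/-! ## §2 The two statements and the proved composition -/

/-- **AnisoBase** (ξ-uniform fixed-lattice femto trace law).  For every coarse lattice `b` and every `s, ε > 0` there is a threshold `β0`
beyond which, for EVERY bare anisotropy `ξ ≥ 1`, the anisotropic Wilson base `(βt, βs) = (β'ξ, β'/ξ)` on `b³` has dyadic zero-flux trace
ratio within `ε` of Lüscher's `r_𝔥(s)` at `T = ⌈sξb/λ(β', b)⌉`.  `ξ = 1` is S-BASE (`Stmt.stub_fixedLatticeTraceLaw`, closed at `b = 1`: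
`Base.fixedLatticeTraceLaw_one`); `ξ → ∞` is the Kogut–Susskind limit.  Content: two-parameter semiclassics of a FIXED finite-dimensional
compact problem, uniform in the Trotter parameter `ξ` (bounded one-loop anisotropy shifts are relatively `O(ḡ²)`). -/
def AnisoBase : Prop :=
  ∀ (b : ℕ) [NeZero b], ∀ s : ℝ, 0 < s → ∀ ε : ℝ, 0 < ε → ∃ β0 : ℝ, ∀ β' : ℝ, β0 ≤ β' → ∀ ξ : ℝ, 1 ≤ ξ →
    |traceRatioA b (β' * ξ) (β' / ξ) (femtoStepsA s ξ β' b) - hTraceRatio s| ≤ ε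

/-- **SliceMatch** (space blocked, time exact).  For `s, ε > 0` and every large enough coarse size `b`, deep in the femto window and for
`L` large, the fine Wilson zero-flux trace ratio at `(L, β)` over `T = femtoSteps s β L` fine steps is within `ε` of the anisotropic base
on `b³` at bare anisotropy `ξ = L/b`, matched label `1/ḡ²(β', b) = 1/ḡ²(β, L)`, `β' ≥ 1`, over the SAME `T` steps.  Content: slice-wise
(spatial-only) renormalisation down to `b`-blocks realised as a dressed COMPRESSION of the positive transfer operator; two-loop running
(W-FLOW) pins the label; last-scale two-sided slow/fast comparison (FreeJaw + a robust fast gap). -/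
def SliceMatch : Prop :=
  ∀ s : ℝ, 0 < s → ∀ ε : ℝ, 0 < ε → ∃ b0 : ℕ, ∀ (b : ℕ) [NeZero b], b0 ≤ b →
    ∃ lam0 : ℝ, 0 < lam0 ∧ ∀ lam : ℝ, 0 < lam → lam ≤ lam0 →
      ∃ L0 : ℕ, ∀ (L : ℕ) [NeZero L], L0 ≤ L → ∀ β : ℝ, InFemtoWindow lam β L → ∀ β' : ℝ, 1 ≤ β' →
        invRunningCoupling β' b = invRunningCoupling β L →
        |traceRatio L β (femtoSteps s β L) - traceRatioA b (β' * ((L : ℝ) / b)) (β' / ((L : ℝ) / b)) (femtoSteps s β L)| ≤ ε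

/-- **Composition (PROVED).**  `AnisoBase → SliceMatch → TwistedTraceScaling` BY NAME: fix `b = max b0 1`; deep in the window a matched
`β' ≥ 1` exists (`Tower.exists_matched`) and is `≥ 1/(4 lam³) ≥ β0` (`Tower.matched_ge`); the two `ε/2`-estimates meet at the common
`T` (`femtoStepsA_matched`), giving the femto trace law, whence the crux by `Tower.twistedTraceScaling_of_femtoTraceLaw`. -/
theorem composition (hA : AnisoBase) (hS : SliceMatch) : TwistedTraceScaling := by
  refine twistedTraceScaling_of_femtoTraceLaw ?_
  intro s hs ε hε
  have hε2 : 0 < ε / 2 := by positivity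
  obtain ⟨b0, hb0⟩ := hS s hs (ε / 2) hε2
  -- the coarse lattice
  set b : ℕ := max b0 1 with hbdef
  haveI : NeZero b := ⟨by positivity⟩
  obtain ⟨lamS, hlamS, hSb⟩ := hb0 b (le_max_left _ _)
  obtain ⟨β0, hβ0⟩ := hA b s hs (ε / 2) hε2
  -- depth: small enough for SliceMatch, for `1/ḡ² ≥ 1`, and for matched couplings to exceed `max β0 1`
  set M : ℝ := max β0 1 with hMdef
  have hMpos : 0 < M := lt_of_lt_of_le one_pos (le_max_right _ _)
  refine ⟨min lamS (min (1 / 2) (1 / (4 * M))), ?_, ?_⟩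
  · positivity
  intro lam hlam hle
  have hleS : lam ≤ lamS := hle.trans (min_le_left _ _)
  have hlehalf : lam ≤ 1 / 2 := hle.trans ((min_le_right _ _).trans (min_le_left _ _))
  have hle1 : lam ≤ 1 := hlehalf.trans (by norm_num)
  have hleM : lam ≤ 1 / (4 * M) := hle.trans ((min_le_right _ _).trans (min_le_right _ _))
  obtain ⟨L0, hL0⟩ := hSb lam hlam hleS
  refine ⟨max L0 b, fun L _ hL β hW => ?_⟩
  have hL0L : L0 ≤ L := (le_max_left _ _).trans hL
  have hbL : b ≤ L := (le_max_right _ _).trans hL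
  -- matched coarse coupling
  obtain ⟨β', hβ'1, hmatch⟩ :=
    exists_matched b (v := invRunningCoupling β L) (one_le_invRunningCoupling_of_window hlam hlehalf hW)
  have hβ'ge : β0 ≤ β' :=
    (le_max_left _ _).trans ((le_of_lam_small hlam hle1 hMpos hleM).trans (matched_ge hlam hW hβ'1 hmatch))
  have hξ : (1 : ℝ) ≤ (L : ℝ) / b := by
    have hbpos : (0 : ℝ) < b := by exact_mod_cast Nat.pos_of_ne_zero (NeZero.ne b)
    rw [le_div_iff₀ hbpos, one_mul]
    exact_mod_cast hbL
  have h1 := hL0 L hL0L β hW β' hβ'1 hmatch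
  have h2 := hβ0 β' hβ'ge ((L : ℝ) / b) hξ
  rw [femtoStepsA_matched s β β' L b hmatch] at h2
  calc |traceRatio L β (femtoSteps s β L) - hTraceRatio s|
      ≤ |traceRatio L β (femtoSteps s β L) - traceRatioA b (β' * ((L : ℝ) / b)) (β' / ((L : ℝ) / b)) (femtoSteps s β L)| +
          |traceRatioA b (β' * ((L : ℝ) / b)) (β' / ((L : ℝ) / b)) (femtoSteps s β L) - hTraceRatio s| := abs_sub_le _ _ _
    _ ≤ ε / 2 + ε / 2 := add_le_add h1 h2
    _ = ε := by ring

/-! ## §3 First lemma of the last-scale engine: the free jaw (Cauchy interlacing for compressions) -/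

/-- Min–max levels of the zero-flux transfer form COMPRESSED to test functions factoring through a block map
`B : GaugeConfig 3 L → GaugeConfig 3 b` (constraint functions factoring through `B` as well).  For the positive self-adjoint zero-flux
transfer operator these are the ordered eigenvalues of the compression `P_V K_β P_V`, `V = {f ∘ B}` — an honest self-adjoint operator for ANY
`B`: no effective action is formed, so no reflection-positivity question arises. [cite: ReedSimonIV1978, Thm. XIII.1] -/
def compressedLevel {L b : ℕ} [NeZero L] [NeZero b] (B : GaugeConfig 3 L SU2 → GaugeConfig 3 b SU2) (β : ℝ) (k : ℕ) : ℝ :=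
  sInf {s | ∃ fs : Fin k → (GaugeConfig 3 b SU2 → ℝ), (∀ i, IsPhys (fs i ∘ B)) ∧
    s = sSup (rayleighSet su2Rep L β fun ψ => (∃ f : GaugeConfig 3 b SU2 → ℝ, ψ = f ∘ B) ∧ ∀ i, l2 ψ (fs i ∘ B) = 0)}

/-- INTERFACE (construction separate): the block map is physicality-preserving — conditional expectation onto `B`-measurable functions sends a
physical test function `φ` to a physical `f ∘ B` with the same pairings against all PHYSICAL `B`-measurable test functions (bounded measurable, so no junk integrals).  True on paper for measurable,
gauge- and twist-COVARIANT block averages (Bałaban's `B_k`, Federbush's SU(2) block spin); never smuggled: a line using it files the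
construction as its own statement. [cite: Balaban1985Averaging] -/
def PreservesPhys {L b : ℕ} [NeZero L] [NeZero b] (B : GaugeConfig 3 L SU2 → GaugeConfig 3 b SU2) : Prop :=
  ∀ φ : GaugeConfig 3 L SU2 → ℝ, IsPhys φ → ∃ f : GaugeConfig 3 b SU2 → ℝ, IsPhys (f ∘ B) ∧
    ∀ g : GaugeConfig 3 b SU2 → ℝ, IsPhys (g ∘ B) → l2 (g ∘ B) φ = l2 (g ∘ B) (f ∘ B)

/-- **FreeJaw** (FIRST LEMMA of the line; Cauchy interlacing): for a physicality-preserving block map every compressed level lies below the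
true one, `λ_k(P_V K_β P_V) ≤ λ_k(K_β)` for all `k` simultaneously — the fine zero-flux spectrum has at least as many low levels as ANY
compression (project the optimal constraints `φ_i ↦ E[φ_i | B]`; on `V` the constraint sets coincide, so the inner `sup` runs over a subset).
The converse (no intruders) is the content of `SliceMatch`'s last scale and needs the dressed subspace + a robust fast gap.
[cite: ReedSimonIV1978, Thm. XIII.1] -/
def FreeJaw : Prop :=
  ∀ (L b : ℕ) [NeZero L] [NeZero b] (B : GaugeConfig 3 L SU2 → GaugeConfig 3 b SU2), PreservesPhys B →
    ∀ β : ℝ, ∀ k : ℕ, compressedLevel B β k ≤ levelValue su2Rep L β k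

end Summit.QuantumFields.YangMills.Cruxes.TwistedTraceScaling.Ideas.TimeExactCompression

end
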